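import Summits.KontsevichZagierPeriods.KontsevichZagierPeriods.Theorems.RootDecompWalshStrataCutBall4Base

/-!
# Root decomposition on Walsh strata — part 108 (gen 13, addendum 1): pairwise cap overlaps — base

Crux `QuadricSignKernel` (item 25393), slice `d = 4`; notation of parts 104–107.  For `2 < ρ ≤ 3`
the caps `K_i(ρ)` of the orthant ball `B₊(√ρ)` overlap pairwise in the regions
`K_{im}(ρ) = {x | xⱼ > 0, x_i ≥ 1, x_m ≥ 1, Σxⱼ² < ρ}` (triple overlaps are empty for `ρ ≤ 3`), and
the face-cut ball is `[C_ρ] = [B₊] − Σᵢ [K_i] + Σ_{i<m} [K_{im}]` inside the rules (part 112).  The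
overlap `K_{01}(ρ)` is again a PRODUCT in the chart `(x₀ − 1, x₁ − 1 | u)`: its fibre over
`(y₀, y₁) ∈ T₂(ρ) = {y₀, y₁ ≥ 0, (1+y₀)² + (1+y₁)² < ρ}` is the quarter disc of radius
`√(ρ − (1+y₀)² − (1+y₁)²) ≤ √(ρ − 2) ≤ 1`, unconstrained by the cube.  This part sets up
`pairRep = [K_{im}(ρ), q]`, the base `T₂(ρ) ⊆ [0,1]²`, its RATIONAL planar representation
`t2Rep = [T₂(ρ), q·(ρ − (1+y₀)² − (1+y₁)²)]` (a `ConicDescent.lenRep`) and the chart source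
`src2Rep = t2Rep × [unit quarter disc, 1]`; part 109 is the chart.
[KontsevichZagier2001 §1.1, §4.1; BCR1998 §2.1]
-/

noncomputable section

open Literature.NumberTheory.Transcendental
open MeasureTheory Set
open MvPolynomial (aeval X C)
open Literature.ModelTheory.ExponentialFields (IsSemialgebraic isSemialgebraic_setOf_eval_pos
  isSemialgebraic_setOf_eval_nonneg isSemialgebraic_setOf_eval_lt)
open Summit.KontsevichZagierPeriods.RootDecompWalshStrata.WalshSpanProof (cellRep cellRep_domain
  cellRep_integrand)
open Summit.KontsevichZagierPeriods.RootDecompWalshStrata.ConeSpecimen (discPoly aeval_discPoly)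
open Summit.KontsevichZagierPeriods.RootDecompWalshStrata.ConicDescent (bddRep bddRep_domain bddRep_integrand
  lenRep)

namespace Summit.KontsevichZagierPeriods.RootDecompWalshStrata.CutBall4

variable {ρ : ℚ}

/-- `ρ ≤ 3 ⇒ ρ ≤ 4`. [elementary] -/
theorem le_four_of_le_three (h3 : ρ ≤ 3) : ρ ≤ 4 := h3.trans (by norm_num)

/-! #### The pairwise overlaps `K_{im}(ρ)` -/

/-- The PAIRWISE CAP OVERLAP `K_{im}(ρ) = {x | xⱼ > 0 ∀ j, x_i ≥ 1, x_m ≥ 1, Σ xⱼ² < ρ}`. -/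
def pairSet (ρ : ℚ) (i m : Fin 4) : Set (Fin 4 → ℝ) :=
  {x | (∀ j, 0 < x j) ∧ (1 ≤ x i ∧ 1 ≤ x m) ∧ nsq x < ρ}

/-- Membership in a pairwise overlap, unfolded. [definition] -/
theorem mem_pairSet {i m : Fin 4} {x : Fin 4 → ℝ} :
    x ∈ pairSet ρ i m ↔ (∀ j, 0 < x j) ∧ (1 ≤ x i ∧ 1 ≤ x m) ∧ nsq x < ρ := Iff.rfl

/-- `K_{im} = K_i ∩ {x_m ≥ 1}`. [definition] -/
theorem pairSet_eq_capSet_inter (ρ : ℚ) (i m : Fin 4) :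
    pairSet ρ i m = capSet ρ i ∩ {x | 1 ≤ x m} := by
  ext x
  simp only [mem_pairSet, mem_inter_iff, mem_capSet, mem_setOf_eq]
  tauto

/-- `K_{im} = K_{mi}`. [definition] -/
theorem pairSet_comm (ρ : ℚ) (i m : Fin 4) : pairSet ρ i m = pairSet ρ m i := by
  ext x
  simp only [mem_pairSet]
  tauto

/-- The pairwise overlaps are `ℚ`-semialgebraic. [BCR1998 §2.1] -/
theorem isSemialgebraic_pairSet (ρ : ℚ) (i m : Fin 4) : IsSemialgebraic ℚ (pairSet ρ i m) := by
  have hm : IsSemialgebraic ℚ {x : Fin 4 → ℝ | 0 ≤ aeval x (X m - 1 : MvPolynomial (Fin 4) ℚ)} :=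
    isSemialgebraic_setOf_eval_nonneg _
  rw [pairSet_eq_capSet_inter]
  convert (isSemialgebraic_capSet ρ i).inter hm using 1
  ext x
  simp only [mem_inter_iff, mem_setOf_eq, map_sub, map_one, MvPolynomial.aeval_X, sub_nonneg]

/-- A pairwise overlap lies in the box `[0, 2]⁴` when `ρ ≤ 4`. [folklore] -/
theorem pairSet_subset_Icc (h4 : ρ ≤ 4) (i m : Fin 4) : pairSet ρ i m ⊆ Icc 0 2 := by
  intro x hx
  obtain ⟨hpos, -, hn⟩ := hx
  have h4' : (ρ : ℝ) ≤ 4 := by exact_mod_cast h4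
  rw [nsq] at hn
  have h0 := hpos 0; have h1 := hpos 1; have hx2 := hpos 2; have hx3 := hpos 3
  refine ⟨fun j => (hpos j).le, fun j => ?_⟩
  fin_cases j <;> simp <;> nlinarith

/-- The pairwise overlaps are bounded. [folklore] -/
theorem isBounded_pairSet (h4 : ρ ≤ 4) (i m : Fin 4) : Bornology.IsBounded (pairSet ρ i m) :=
  (isCompact_Icc (a := (0 : Fin 4 → ℝ)) (b := 2)).isBounded.subset (pairSet_subset_Icc h4 i m)

/-- **`pairRep ρ q i m = [K_{im}(ρ), q]`**, constant rational weight `q` (`ρ ≤ 4`).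
[KontsevichZagier2001 §1.1] -/
def pairRep (ρ q : ℚ) (h4 : ρ ≤ 4) (i m : Fin 4) : KZ.IntegralRep 4 :=
  bddRep (pairSet ρ i m) (isSemialgebraic_pairSet ρ i m) (isBounded_pairSet h4 i m)
    (fun _ => (q : ℝ)) (isSemialgebraicFunOn_ratCast (isSemialgebraic_pairSet ρ i m) q) |(q : ℝ)|
    fun _ _ => le_rfl

/-- The domain of `pairRep`. [definition] -/
@[simp] theorem pairRep_domain (q : ℚ) (h4 : ρ ≤ 4) (i m : Fin 4) :
    (pairRep ρ q h4 i m).domain = pairSet ρ i m := rfl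

/-- The integrand of `pairRep`. [definition] -/
@[simp] theorem pairRep_integrand (q : ℚ) (h4 : ρ ≤ 4) (i m : Fin 4) (x : Fin 4 → ℝ) :
    (pairRep ρ q h4 i m).integrand x = (q : ℝ) := rfl

/-- `[K_{im}, q] ≡ [K_{mi}, q]` (same set). [KontsevichZagier2001 §1.2] -/
theorem of_pairRep_sub_of_pairRep_comm_mem_relations (q : ℚ) (h4 : ρ ≤ 4) (i m : Fin 4) :
    KZ.of (pairRep ρ q h4 i m) - KZ.of (pairRep ρ q h4 m i) ∈ KZ.relations :=
  KZ.of_sub_of_mem_relations_of_eqOn (by rw [pairRep_domain, pairRep_domain, pairSet_comm])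
    fun x _ => by rw [pairRep_integrand, pairRep_integrand]

/-! #### The doubly translated base `T₂(ρ)` and the planar representation `t2Rep` -/

/-- `T₂(ρ) = {(y₀, y₁) | 0 ≤ y₀, 0 ≤ y₁, (1 + y₀)² + (1 + y₁)² < ρ}` (the overlap's shadow, translated
by `xᵢ = 1 + yᵢ`). -/
def t2Set (ρ : ℚ) : Set (Fin 2 → ℝ) :=
  {y | 0 ≤ y 0 ∧ 0 ≤ y 1 ∧ (1 + y 0) ^ 2 + (1 + y 1) ^ 2 < ρ}

/-- Membership in `T₂(ρ)`, unfolded. [definition] -/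
theorem mem_t2Set {y : Fin 2 → ℝ} :
    y ∈ t2Set ρ ↔ 0 ≤ y 0 ∧ 0 ≤ y 1 ∧ (1 + y 0) ^ 2 + (1 + y 1) ^ 2 < ρ := Iff.rfl

/-- `T₂(ρ)` is `ℚ`-semialgebraic. [BCR1998 §2.1] -/
theorem isSemialgebraic_t2Set (ρ : ℚ) : IsSemialgebraic ℚ (t2Set ρ) := by
  have h0 : IsSemialgebraic ℚ {y : Fin 2 → ℝ | 0 ≤ aeval y (X 0 : MvPolynomial (Fin 2) ℚ)} :=
    isSemialgebraic_setOf_eval_nonneg _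
  have h1 : IsSemialgebraic ℚ {y : Fin 2 → ℝ | 0 ≤ aeval y (X 1 : MvPolynomial (Fin 2) ℚ)} :=
    isSemialgebraic_setOf_eval_nonneg _
  have h3 : IsSemialgebraic ℚ {y : Fin 2 → ℝ |
      aeval y ((1 + X 0) ^ 2 + (1 + X 1) ^ 2 : MvPolynomial (Fin 2) ℚ) <
        aeval y (C ρ : MvPolynomial (Fin 2) ℚ)} :=
    isSemialgebraic_setOf_eval_lt _ _
  convert (h0.inter h1).inter h3 using 1
  ext y
  simp only [t2Set, mem_inter_iff, mem_setOf_eq, map_add, map_pow, map_one, MvPolynomial.aeval_X,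
    MvPolynomial.aeval_C, eq_ratCast]
  tauto

/-- `T₂(ρ) ⊆ [0, 1]²` when `ρ ≤ 4` (`(1+y₀)² < ρ − 1 ≤ 3 ⇒ y₀ < 1`). [folklore] -/
theorem t2Set_subset_Icc (h4 : ρ ≤ 4) : t2Set ρ ⊆ Icc 0 1 := by
  intro y hy
  obtain ⟨h0, h1, hr⟩ := hy
  have h4' : (ρ : ℝ) ≤ 4 := by exact_mod_cast h4
  refine ⟨fun j => ?_, fun j => ?_⟩ <;> fin_cases j <;> simp <;> nlinarith

/-- The fibre radius squared over the base: `g₂(y₀, y₁) = ρ − (1 + y₀)² − (1 + y₁)²`. -/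
def g2 (ρ : ℚ) (y : Fin 2 → ℝ) : ℝ := (ρ : ℝ) - (1 + y 0) ^ 2 - (1 + y 1) ^ 2

/-- `g₂ > 0` on `T₂(ρ)`. [definition] -/
theorem g2_pos {y : Fin 2 → ℝ} (hy : y ∈ t2Set ρ) : 0 < g2 ρ y := by
  rw [g2]; linarith [hy.2.2]

/-- `g₂ ≤ 1` on `T₂(ρ)` when `ρ ≤ 3` (`(1 + yᵢ)² ≥ 1`). [folklore] -/
theorem g2_le_one (h3 : ρ ≤ 3) {y : Fin 2 → ℝ} (hy : y ∈ t2Set ρ) : g2 ρ y ≤ 1 := by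
  have h3' : (ρ : ℝ) ≤ 3 := by exact_mod_cast h3
  rw [g2]; nlinarith [hy.1, hy.2.1]

/-- `g₂` is a `ℚ`-polynomial function on any `ℚ`-semialgebraic planar set. [BCR1998 §2.2] -/
theorem isSemialgebraicFunOn_g2 {S : Set (Fin 2 → ℝ)} (hS : IsSemialgebraic ℚ S) :
    IsSemialgebraicFunOn ℚ S (g2 ρ) :=
  (isSemialgebraicFunOn_aeval hS
      (C ρ - (1 + X 0) ^ 2 - (1 + X 1) ^ 2 : MvPolynomial (Fin 2) ℚ)).congr fun y _ => by
    simp only [g2, map_sub, map_add, map_pow, map_one, MvPolynomial.aeval_X, MvPolynomial.aeval_C,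
      eq_ratCast]

/-- **`t2Rep ρ q = [T₂(ρ), q·(ρ − (1+y₀)² − (1+y₁)²)]`** — a RATIONAL planar representation with
polynomial weight (the length representation of the band `0 < t < g₂` over `T₂(ρ)`), `ρ ≤ 3`.
[KontsevichZagier2001 §1.1] -/
def t2Rep (ρ q : ℚ) (h3 : ρ ≤ 3) : KZ.IntegralRep 2 :=
  lenRep (t2Set ρ) (isSemialgebraic_t2Set ρ) (t2Set_subset_Icc (le_four_of_le_three h3))
    (fun _ => (0 : ℝ)) (g2 ρ) (isSemialgebraicFunOn_zero (isSemialgebraic_t2Set ρ))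
    (isSemialgebraicFunOn_g2 (isSemialgebraic_t2Set ρ)) (fun _ _ => le_rfl) (fun _ hy => (g2_pos hy).le)
    (fun _ hy => g2_le_one h3 hy) q

/-- The domain of `t2Rep`. [definition] -/
@[simp] theorem t2Rep_domain (q : ℚ) (h3 : ρ ≤ 3) : (t2Rep ρ q h3).domain = t2Set ρ := rfl

/-- The integrand of `t2Rep`. [definition] -/
@[simp] theorem t2Rep_integrand (q : ℚ) (h3 : ρ ≤ 3) (y : Fin 2 → ℝ) :
    (t2Rep ρ q h3).integrand y = (q : ℝ) * (g2 ρ y - 0) := rfl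

/-! #### The source: `t2Rep × (unit quarter disc)` -/

/-- The source of the overlap chart: the product of `t2Rep ρ q` with the unit quarter disc
`[(0,1)² ∩ {u₀² + u₁² < 1}, 1]` (dimension `2 + 2`). [KontsevichZagier2001 §4.1] -/
def src2Rep (ρ q : ℚ) (h3 : ρ ≤ 3) : KZ.IntegralRep (2 + 2) := (t2Rep ρ q h3).prod (cellRep discPoly 1)

/-- Membership in the source domain, in coordinates `z = (y₀, y₁, u₀, u₁)`. [definition] -/
theorem mem_src2_iff (q : ℚ) (h3 : ρ ≤ 3) {z : Fin (2 + 2) → ℝ} :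
    z ∈ (src2Rep ρ q h3).domain ↔
      (0 ≤ z 0 ∧ 0 ≤ z 1 ∧ (1 + z 0) ^ 2 + (1 + z 1) ^ 2 < ρ) ∧
        ((0 < z 2 ∧ z 2 < 1) ∧ (0 < z 3 ∧ z 3 < 1)) ∧ z 2 ^ 2 + z 3 ^ 2 < 1 := by
  have hD : (fun j : Fin 2 => z (Fin.natAdd 2 j)) ∈ (cellRep discPoly 1).domain ↔
      ((0 < z 2 ∧ z 2 < 1) ∧ (0 < z 3 ∧ z 3 < 1)) ∧ 0 < 1 - z 2 ^ 2 - z 3 ^ 2 := by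
    rw [cellRep_domain, mem_setOf_eq, Fin.forall_fin_two, aeval_discPoly]
    exact Iff.rfl
  change ((0 ≤ z 0 ∧ 0 ≤ z 1 ∧ (1 + z 0) ^ 2 + (1 + z 1) ^ 2 < (ρ : ℝ)) ∧
    (fun j : Fin 2 => z (Fin.natAdd 2 j)) ∈ (cellRep discPoly 1).domain) ↔ _
  rw [hD]
  constructor
  · rintro ⟨hT, hc, hd⟩
    exact ⟨hT, hc, by linarith⟩
  · rintro ⟨hT, hc, hd⟩
    exact ⟨hT, hc, by linarith⟩

/-- The integrand of the source is `q·(ρ − (1+y₀)² − (1+y₁)²)`. [KontsevichZagier2001 §4.1] -/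
theorem src2Rep_integrand (q : ℚ) (h3 : ρ ≤ 3) (z : Fin (2 + 2) → ℝ) :
    (src2Rep ρ q h3).integrand z = (q : ℝ) * ((ρ : ℝ) - (1 + z 0) ^ 2 - (1 + z 1) ^ 2) := by
  rw [src2Rep, KZ.IntegralRep.prod_integrand_eq, KZ.IntegralRep.prodFun_apply, t2Rep_integrand,
    cellRep_integrand]
  change (q : ℝ) * (((ρ : ℝ) - (1 + z 0) ^ 2 - (1 + z 1) ^ 2) - 0) * ((1 : ℚ) : ℝ) = _
  push_cast
  ring

end Summit.KontsevichZagierPeriods.RootDecompWalshStrata.CutBall4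

end
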